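import Mathlib

/-!
# STUB-IDEAS k1 (gen 27) — «ONE UNIVERSAL BIT ON THE UNRAMIFIED LINE»
  (technique: weaken / strengthen — strongest provable form of R176⁺ / R175b (ii)(iii)(iv),
   weakest sufficient form of R196 for LOWER)

Sketch for the crux `SplitBadTwoLowerHalfOfFacts` (stmt-BirchSwinnertonDyer-27851), stub
`stub_heegnerIndexLowerAtTwo` of `Lines/kside_finite_two.lean` (v2, sha16 `f2bd84c029a8a938`),
which is NOT re-typed here.  Nothing below is a route, a registry verb or a Theorems proposal;
BSD is NOT proved by any of this.  Every declaration is PROVED (no `sorry`).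

Contents (the informal dictionary is on the card `Ideas/stub-heegnerindexloweratwo-k1-g27.md`):

* §1 `ArtinSchreier` — over a finite field of characteristic 2 the Artin–Schreier map
  `℘ x = x*x + x` is additive with kernel `{0,1}`; hence its image has index `2`.  This is the
  residue-field shadow of «`coker (log : U¹(F) → 2𝒪_F) ≅ ℤ/2` for every UNRAMIFIED 2-adic field
  `F`», i.e. of the claim that the integral frame functional `½·Lg` on the unramified `ℤ₂`-line
  has ONE universal bit of cokernel, uniformly in the tower (R176⁺ strongest provable form).
* §2 `LogTail` — `v₂(2^m / m) ≥ 2` for `m ≥ 3` (as `padicValNat 2 m + 2 ≤ m`): the terms of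
  `log(1+2x)` beyond the quadratic one vanish mod `4`, so `log(1+2x) ≡ 2(x − x²) (mod 4)` and the
  map `U¹/U² → 2𝒪/4𝒪 ≅ k` IS `−℘` (feeds §1).
* §3 `Calibration` — two `Λ`-linear functionals on a module with `f = r·g`: the ratio `r` is READ at
  a character by evaluating both on ANY test vector with non-vanishing `g`-value
  (`eval_ratio_eq_div`), and LOWER's one-sided consumption: a bound `v(r) ≤ ϖ` alone gives
  `v(g u) + ϖ ≥ v(f u)` (`lower_oneSided_budget`) — the weakest sufficient form of R196.
* §4 `DescentTable` — the six dyadic keys `u ∈ {−1, 3, 2, −2, 6, −6}`: Hilbert symbols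
  `(−1,u)₂`, `(5,u)₂` from the closed formula, the inertia character values `ϑ(−1)`, `5·ϑ(5)` in
  both bookings, and the EXACT orders of the descent homology `H₀, H₁, H₂` of
  `H_v = ⟨−1⟩ × ⟨5⟩ ≅ C₂ × ℤ₂` with coefficients `ℤ₂(ϑ)` (R175b (ii) strongest provable form:
  numbers, not finiteness), certified by `decide` from the presentation
  `A = ℤ₂/(ϑ(5) − 1)`, `H₀ = A/(ε−1)`, `H₁ = ker(ε−1)/N`, `H₂ = ker N/(ε−1)`.
-/

set_option linter.dupNamespace false
set_option autoImplicit false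

namespace Summit.BirchSwinnertonDyer.BirchSwinnertonDyer.Cruxes.SplitBadTwoLowerHalfOfFacts.StubIdeasK1G27

/-! ## §1 Artin–Schreier: the universal bit -/
section ArtinSchreier

variable (k : Type*) [Field k] [CharP k 2]

/-- The Artin–Schreier map `x ↦ x² + x`, additive in characteristic `2`. -/
def artinSchreier : k →+ k where
  toFun x := x * x + x
  map_zero' := by simp
  map_add' x y := by
    rw [CharTwo.add_mul_self]
    abel

theorem artinSchreier_apply (x : k) : artinSchreier k x = x * x + x := rfl

/-- In characteristic `2`, `x² + x = 0 ↔ x = 0 ∨ x = 1`. -/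
theorem artinSchreier_eq_zero_iff (x : k) : artinSchreier k x = 0 ↔ x = 0 ∨ x = 1 := by
  rw [artinSchreier_apply]
  constructor
  · intro h
    have hx : x * (x + 1) = 0 := by rw [mul_add, mul_one]; exact h
    rcases mul_eq_zero.mp hx with h0 | h1
    · exact Or.inl h0
    · right
      have : x = -1 := eq_neg_of_add_eq_zero_left h1
      rw [this, CharTwo.neg_eq]
  · rintro (rfl | rfl)
    · simp
    · rw [mul_one]; exact CharTwo.add_self_eq_zero 1

/-- The kernel of the Artin–Schreier map is `{0, 1}` as a set. -/
theorem artinSchreier_ker_eq :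
    ((artinSchreier k).ker : Set k) = {0, 1} := by
  ext x
  simp only [SetLike.mem_coe, AddMonoidHom.mem_ker, Set.mem_insert_iff, Set.mem_singleton_iff]
  exact artinSchreier_eq_zero_iff k x

/-- The kernel of the Artin–Schreier map has exactly two elements. -/
theorem natCard_artinSchreier_ker : Nat.card (artinSchreier k).ker = 2 := by
  change Nat.card ((artinSchreier k).ker : Set k) = 2
  rw [artinSchreier_ker_eq, Nat.card_coe_set_eq, Set.ncard_pair (zero_ne_one' k)]

/-- **The universal bit.**  Over a FINITE field of characteristic `2` the image of the
Artin–Schreier map has index exactly `2` (residue shadow of `coker(log|U¹) ≅ ℤ/2` in every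
layer of the unramified `ℤ₂`-tower). -/
theorem artinSchreier_range_index [Finite k] : (artinSchreier k).range.index = 2 := by
  have h1 : (artinSchreier k).ker.index = Nat.card (artinSchreier k).range :=
    AddSubgroup.index_ker _
  have h2 : Nat.card (artinSchreier k).ker * (artinSchreier k).ker.index = Nat.card k :=
    AddSubgroup.card_mul_index _
  have h3 : Nat.card (artinSchreier k).range * (artinSchreier k).range.index = Nat.card k :=
    AddSubgroup.card_mul_index _
  rw [natCard_artinSchreier_ker, h1] at h2
  have hpos : 0 < Nat.card (artinSchreier k).range := Nat.card_pos
  have h4 : Nat.card (artinSchreier k).range * (artinSchreier k).range.index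
      = Nat.card (artinSchreier k).range * 2 := by rw [h3, ← h2, mul_comm]
  exact Nat.eq_of_mul_eq_mul_left hpos h4

/-- Equivalently: `|k| = 2 · |℘(k)|`. -/
theorem natCard_eq_two_mul_range [Finite k] :
    Nat.card k = 2 * Nat.card (artinSchreier k).range := by
  have h3 : Nat.card (artinSchreier k).range * (artinSchreier k).range.index = Nat.card k :=
    AddSubgroup.card_mul_index _
  rw [artinSchreier_range_index] at h3
  omega

/-- The relative trace commutes with Artin–Schreier (Frobenius is a ring hom commuting with every
ring automorphism), so the bit is COMPATIBLE along the tower: for any ring hom `σ` of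
characteristic-2 rings, `σ (x² + x) = (σ x)² + σ x`. -/
theorem map_artinSchreier {k' : Type*} [Field k'] [CharP k' 2] (σ : k →+* k') (x : k) :
    σ (artinSchreier k x) = artinSchreier k' (σ x) := by
  simp [artinSchreier_apply, map_add, map_mul]

end ArtinSchreier

/-! ## §2 The tail of `log(1+2x)` vanishes mod 4 -/
section LogTail

/-- `m < 2^(m-1)` for `m ≥ 3`. -/
theorem lt_two_pow_pred {m : ℕ} (hm : 3 ≤ m) : m < 2 ^ (m - 1) := by
  induction m, hm using Nat.le_induction with
  | base => decide
  | succ n hn ih =>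
    have : n + 1 - 1 = (n - 1) + 1 := by omega
    rw [this, pow_succ]
    omega

/-- **Log tail.**  For `m ≥ 3`, `v₂(m) + 2 ≤ m`, i.e. `v₂(2^m/m) ≥ 2`: the `m`-th term
`±(2x)^m/m` of `log(1+2x)` is `≡ 0 (mod 4)`; only `2x − 2x²` survives mod `4`. -/
theorem padicValNat_two_add_two_le {m : ℕ} (hm : 3 ≤ m) : padicValNat 2 m + 2 ≤ m := by
  have hm0 : m ≠ 0 := by omega
  have hlog : padicValNat 2 m ≤ Nat.log 2 m := padicValNat_le_nat_log m
  have hlt : m < 2 ^ (m - 1) := lt_two_pow_pred hm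
  have : Nat.log 2 m < m - 1 := by
    rw [Nat.log_lt_iff_lt_pow (by norm_num) hm0]
    exact hlt
  omega

/-- Sanity values: `v₂(2³/3) = 3`, `v₂(2⁴/4) = 2` (the bound of `padicValNat_two_add_two_le`
is attained at `m = 4`), `v₂(2⁵/5) = 5`. -/
example : padicValNat 2 (2 ^ 2) + 2 = 4 := by
  rw [padicValNat.prime_pow]

end LogTail

/-! ## §3 Calibration on a test vector; LOWER's one-sided budget -/
section Calibration

variable {R M K : Type*} [CommRing R] [AddCommGroup M] [Module R M] [Field K]

/-- **Ratio read on a test vector.**  If two `R`-linear functionals satisfy `f = r • g`, then at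
any character `ev : R →+* K` and any test vector `u₀` with `ev (g u₀) ≠ 0`,
`ev r = ev (f u₀) / ev (g u₀)` — the constant of the (2)₂ node at ONE character is computable
from ANY convenient norm-coherent unit, not only from the elliptic unit. -/
theorem eval_ratio_eq_div (ev : R →+* K) (f g : M →ₗ[R] R) (r : R)
    (hfg : ∀ m, f m = r * g m) (u₀ : M) (h0 : ev (g u₀) ≠ 0) :
    ev r = ev (f u₀) / ev (g u₀) := by
  rw [hfg, map_mul]
  field_simp

/-- The ratio so read does not depend on the test vector. -/
theorem eval_ratio_indep (ev : R →+* K) (f g : M →ₗ[R] R) (r : R)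
    (hfg : ∀ m, f m = r * g m) (u₀ u₁ : M) (h0 : ev (g u₀) ≠ 0) (h1 : ev (g u₁) ≠ 0) :
    ev (f u₀) / ev (g u₀) = ev (f u₁) / ev (g u₁) := by
  rw [← eval_ratio_eq_div ev f g r hfg u₀ h0, ← eval_ratio_eq_div ev f g r hfg u₁ h1]

/-- **LOWER's one-sided budget (weakest sufficient form of R196).**  With `f u = r * g u` read in
`ℕ` through 2-adic valuations (`a = v(f u)`, `b = v(g u)`, `c = v(r)`, `a = c + b`), an UPPER
bound `c ≤ ϖ` on the ratio's valuation alone yields `a ≤ ϖ + b`, i.e. `v(g u) ≥ v(f u) − ϖ`: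
LOWER never needs the exact cokernel, only a ceiling for it. -/
theorem lower_oneSided_budget {a b c ϖ : ℕ} (hadd : a = c + b) (hc : c ≤ ϖ) : a ≤ ϖ + b := by
  omega

/-- The multiplicative form over `ℕ` with genuine 2-adic valuations: if `F = r * G` with
`r, G ≠ 0` and `v₂ r ≤ ϖ` then `v₂ F ≤ ϖ + v₂ G`. -/
theorem lower_oneSided_budget_padic {F G r ϖ : ℕ} (hr : r ≠ 0) (hG : G ≠ 0)
    (hF : F = r * G) (hϖ : padicValNat 2 r ≤ ϖ) :
    padicValNat 2 F ≤ ϖ + padicValNat 2 G := by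
  haveI : Fact (Nat.Prime 2) := ⟨Nat.prime_two⟩
  rw [hF, padicValNat.mul hr hG]
  omega

end Calibration

/-! ## §4 The six dyadic keys: Hilbert symbols, inertia characters, descent homology orders -/
section DescentTable

/-- A dyadic key: the class of `u = 2^a · u'` (`u'` odd) in `ℚ₂ˣ/ℚ₂ˣ²`, recorded as
`(a mod 2, u' mod 8)`. -/
structure Key where
  /-- parity of `v₂(u)` -/
  evenVal : Bool
  /-- `u' mod 8 ∈ {1,3,5,7}` -/
  unitMod8 : ℕ

/-- The six keys of the crux, `u ∈ {−1, 3, 2, −2, 6, −6}`: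
`−1 = 2⁰·7`, `3 = 2⁰·3`, `2 = 2¹·1`, `−2 = 2¹·7`, `6 = 2¹·3`, `−6 = 2¹·5` (mod 8 on the unit part). -/
def keys : List (ℤ × Key) :=
  [(-1, ⟨true, 7⟩), (3, ⟨true, 3⟩), (2, ⟨false, 1⟩), (-2, ⟨false, 7⟩), (6, ⟨false, 3⟩),
   (-6, ⟨false, 5⟩)]

/-- `(−1, u)₂ = (−1)^{(u'−1)/2}` (`(−1,2)₂ = +1` since `2 = N(1+i)`), as a sign `±1 : ℤ`. -/
def hilbertNegOne (κ : Key) : ℤ := if κ.unitMod8 % 4 = 3 then -1 else 1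

/-- `(5, u)₂ = (−1)^{v₂ u}` (`5` spans the unramified class), as a sign. -/
def hilbertFive (κ : Key) : ℤ := if κ.evenVal then 1 else -1

/-- BOOKINGS.  For a rank-one coefficient `T` trivialised over `ℚ₂^{ab}`,
`H²_Iw(ℚ₂^{ab}, T) = (colim H⁰(·, T^∨(1) ⊗ ℚ₂/ℤ₂))^∨ ≅ T(−1)` (check: `T = ℤ₂` gives
`lim μ_{2^∞}(L')^∨ = ℤ₂(−1)`), so the descent character on INERTIA `H_v ≅ ℤ₂ˣ = ⟨−1⟩ × ⟨5⟩` is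
`ϑ = χ_T · χ_cyc⁻¹ |_{I₂}`.  ÉTALE (`exp*`) booking `T = unr(β) ⊗ χ_u` (= `T_𝔭W|_{G_v}`):
`ϑ = χ_u · χ_cyc⁻¹` on inertia, `ϑ(−1) = −(−1,u)₂`.  (This CORRECTS the label `a = 0` for this
booking in k1-g26's table: the exponent of `χ_cyc` is `−1` here and `0` in the log booking; the
numbers below are cross-checked against a direct computation of `H²_Iw(ℚ₂^{ur,2}, T) = H₀`.) -/
def thetaEtNegOne (κ : Key) : ℤ := - hilbertNegOne κ

/-- `5 · ϑ(5) = (5,u)₂` in the étale booking (`χ_cyc(rec 5) = 5^{±1}`; either sign convention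
gives the same valuation), so `v₂(ϑ(5) − 1) = v₂((5,u)₂ − 5)`. -/
def fiveThetaEtFiveSubFive (κ : Key) : ℤ := hilbertFive κ - 5

/-- LOG booking `T = ℤ₂(1) ⊗ unr(β)⁻¹ ⊗ χ_u` (the frame's receptacle at `v`: Hodge–Tate
weight one, `H¹ = H¹_f`, Bloch–Kato log available): `T(−1) = unr(β⁻¹)·χ_u`, so on inertia
`ϑ' = χ_u`: `ϑ'(−1) = (−1,u)₂`, `ϑ'(5) = (5,u)₂` (order exactly `2` for all six keys). -/
def thetaLgNegOne (κ : Key) : ℤ := hilbertNegOne κ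
def thetaLgFiveSubOne (κ : Key) : ℤ := hilbertFive κ - 1

/-- `v₂` of an integer through `natAbs`, `0 ↦ 1000` standing for `∞` (only used on the finite
table). -/
def v2 (z : ℤ) : ℕ := if z = 0 then 1000 else padicValNat 2 z.natAbs

/-- Orders (as exponents of `2`) of the descent homology of `H_v = ⟨−1⟩ × ⟨5⟩ ≅ C₂ × ℤ₂` with
coefficients `ℤ₂(ϑ)`, from the presentation `A = ℤ₂/(ϑ(5)−1)` (cyclic of order `2^k`,
`k = v₂(ϑ(5)−1) ≥ 1`), `ε = ϑ(−1)`: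
`H₀ = A/(ε−1)A`, `H₁ = ker(ε−1|A)/(1+ε)A`, `H₂ = ker(1+ε|A)/(ε−1)A`.
For `ε = 1`: `(k, 1, 1)`; for `ε = −1` (on `ℤ/2^k`, `k ≥ 1`): `(1, 1, 1)`. -/
def homologyExponents (ε : ℤ) (k : ℕ) : ℕ × ℕ × ℕ :=
  if ε = 1 then (k, min k 1, min k 1) else (min k 1, min k 1, min k 1)

/-- The étale-booking table `(u, log₂|H₀|, log₂|H₁|, log₂|H₂|)`. -/
def tableEt : List (ℤ × ℕ × ℕ × ℕ) :=
  keys.map fun ⟨u, κ⟩ => (u, homologyExponents (thetaEtNegOne κ) (v2 (fiveThetaEtFiveSubFive κ)))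

/-- The log-booking table (the frame's receptacle). -/
def tableLg : List (ℤ × ℕ × ℕ × ℕ) :=
  keys.map fun ⟨u, κ⟩ => (u, homologyExponents (thetaLgNegOne κ) (min (v2 (thetaLgFiveSubOne κ)) (v2 (thetaLgNegOne κ - 1)) ))

/-- Hilbert symbols of the six keys: `(−1,u)₂ = −1` exactly for `u ∈ {−1, 3, −2, 6}`,
`(5,u)₂ = −1` exactly for the even keys. -/
theorem hilbert_table :
    keys.map (fun ⟨u, κ⟩ => (u, hilbertNegOne κ, hilbertFive κ))
      = [(-1, -1, 1), (3, -1, 1), (2, 1, -1), (-2, -1, -1), (6, -1, -1), (-6, 1, -1)] := by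
  decide

/-- `v₂((5,u)₂ − 5) = 2` for odd keys (`1 − 5 = −4`) and `= 1` for even keys (`−1 − 5 = −6`);
so `ϑ(5) ≠ 1` for ALL six keys in the étale booking (the descent homology is FINITE, K29). -/
theorem v2n_four : padicValNat 2 4 = 2 := by
  rw [show (4 : ℕ) = 2 ^ 2 by norm_num, padicValNat.prime_pow]

theorem v2n_two : padicValNat 2 2 = 1 := padicValNat_self

theorem v2n_six : padicValNat 2 6 = 1 := by
  haveI : Fact (Nat.Prime 2) := ⟨Nat.prime_two⟩
  haveI : Fact (Nat.Prime 3) := ⟨Nat.prime_three⟩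
  rw [show (6 : ℕ) = 2 * 3 by norm_num, padicValNat.mul (by norm_num) (by norm_num), padicValNat_self,
    padicValNat_primes (p := 2) (q := 3) (by norm_num)]

theorem v2_neg_four : v2 (-4) = 2 := by simp [v2, v2n_four]
theorem v2_neg_six : v2 (-6) = 1 := by simp [v2, v2n_six]
theorem v2_neg_two : v2 (-2) = 1 := by simp [v2]
theorem v2_zero : v2 0 = 1000 := by simp [v2]

/-- **R175b (ii), strongest provable form — EXACT ORDERS, étale booking** (`T = unr(β) ⊗ χ_u`):
`|H₀| = 4` for the odd keys `u ∈ {−1, 3}` (there `ϑ(−1) = +1` and `A = ℤ₂/(5^{±1}−1) = ℤ/4`),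
`|H₀| = 2` for the even keys; `|H₁| = |H₂| = 2` throughout.  Cross-check of the `H₀` column:
`H₀(H_v, H²_Iw(ℚ₂^{ab}, T)) = H²_Iw(ℚ₂^{ur,2}, T) = ((ℚ₂/ℤ₂)(χ_cyc·χ_u))^{G_{F_∞}}{}^∨`, and on
`G_{F_∞}` (`F_∞ = ℚ₂^{ur,2}`, `√u ∈ F_∞(μ_{2^∞})` for all six `u`) the character `a ↦ a·ψ_u(a)` of
`ℤ₂ˣ` has `min v₂(aψ_u(a) − 1) = 2` for `ψ_u` of conductor `4` (odd keys: kernel `1 + 4ℤ₂`) and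
`= 1` for conductor `8` (even keys) — `ℤ/4`, `ℤ/2` as in the table. -/
theorem descentHomology_et_table :
    tableEt = [(-1, 2, 1, 1), (3, 2, 1, 1), (2, 1, 1, 1), (-2, 1, 1, 1), (6, 1, 1, 1),
      (-6, 1, 1, 1)] := by
  simp [tableEt, keys, homologyExponents, thetaEtNegOne, fiveThetaEtFiveSubFive, hilbertNegOne,
    hilbertFive, v2_neg_four, v2_neg_six]

/-- **LOG booking** (`T = ℤ₂(1) ⊗ unr(β)⁻¹ ⊗ χ_u`, the frame's `T(key)_v`): `|H₀| = |H₁| = |H₂| = 2`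
for all six keys (the critic's K29 table: `ϑ'|_{I₂} = χ_u` of order `2`; cross-check `H₀ =
H²_Iw(ℚ₂^{ur,2}, T) = ℤ/2` = `hTwoIw_bit`).  For the odd keys `ϑ'(5) = 1`
(`⟨5⟩` acts trivially, `A = ℤ₂` is NOT finite) and the exponents come instead from Künneth
`H_n(C₂ × ℤ₂, M) = H_n(C₂, M) ⊕ H_{n−1}(C₂, M)` with `ε = ϑ'(−1) = −1`: `(ℤ/2, 0 ⊕ ℤ/2, ℤ/2 ⊕ 0)`
— the same triple `(1,1,1)`, which is what the `min … (v2 (ϑ'(−1) − 1))` entry encodes. -/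
theorem descentHomology_lg_table :
    tableLg = [(-1, 1, 1, 1), (3, 1, 1, 1), (2, 1, 1, 1), (-2, 1, 1, 1), (6, 1, 1, 1),
      (-6, 1, 1, 1)] := by
  simp [tableLg, keys, homologyExponents, thetaLgNegOne, thetaLgFiveSubOne, hilbertNegOne,
    hilbertFive, v2_neg_two, v2_zero]

/-- **R175b (iii), strongest provable form (log booking).**
`H²_Iw(ℚ₂^{ur,2}, T) ≅ H⁰(ℚ₂^{ur,2}, T^∨(1) ⊗ ℚ₂/ℤ₂)^∨` and `T^∨(1) = unr(β)·χ_u =: ρ`; on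
`G_{F_∞}` the unramified factor dies (`ℤ₂ˣ` is pro-2, `Gal(ℚ₂^{ur}/F_∞)` is pro-odd) and `χ_u`
takes the value `−1`; `v₂(−1 − 1) = 1` while every `ρ(g) ≡ 1 (mod 2)`: the invariants are
`(ℚ₂/ℤ₂)[2]`, ONE bit, for all six keys (étale booking: `ℤ/4` odd / `ℤ/2` even, the `H₀` column
of `descentHomology_et_table`).  The arithmetic input: -/
theorem hTwoIw_bit : v2 ((-1 : ℤ) - 1) = 1 := by
  rw [show ((-1 : ℤ) - 1) = -2 by norm_num]; exact v2_neg_two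

end DescentTable

/-! ## §5 Anti-costume witnesses -/
section Witness

/-- The index-`2` phenomenon of §1 is genuinely characteristic-`2`: over `ZMod 3` the map
`x ↦ x² + x` is not even additive (`℘(1) + ℘(1) = 1 ≠ 0 = ℘(2)`), so nothing here is a
tautology of finite fields. -/
example : ((1 : ZMod 3) * 1 + 1) + (1 * 1 + 1) ≠ (2 : ZMod 3) * 2 + 2 := by decide

/-- The bound of §2 fails at `m = 2` (`v₂ 2 + 2 = 3 > 2`): the quadratic term of `log(1+2x)`
DOES survive mod `4` — it is the `x²` of Artin–Schreier. -/
example : ¬ (padicValNat 2 2 + 2 ≤ 2) := by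
  rw [padicValNat_self]; omega

end Witness

end Summit.BirchSwinnertonDyer.BirchSwinnertonDyer.Cruxes.SplitBadTwoLowerHalfOfFacts.StubIdeasK1G27
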